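import Summits.CriticalPhenomena.PercolationContinuityZ3.Theorems.PercNearOneGluingNoHeavyQuantLightSlicePieces
import Summits.CriticalPhenomena.PercolationContinuityZ3.Theorems.PercNearOneGluingNoHeavyQuantLightSliceResidual
import Summits.CriticalPhenomena.PercolationContinuityZ3.Theorems.PercNearOneGluingNoHeavyQuantFarTreeRowOfLightSliceGateMove
import HarnessLib

/-!
# QUANT lane R8, T-DEC: THE ASSEMBLY OF `LightSliceCore` FROM CELLS — `LightSliceCore ⟸ LightSliceLowCross ∧ LightSliceWide`
# (census-2 g59: statement (II) of the R8 law level is reduced to its POOLED RESIDUE; everything else is landed cell lemmas)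

builds on p205010 (kernel theorem, internal audit signed; external expert review pending)

Support file (`--supports stmt-CriticalPhenomena-4575`), QUANT lane seat prim-quant-census-2 (gen 59), rung R8 of
`run/shared/lean/prim/quant/LADDER.md`.  Memo `run/shared/lean/prim/quant/prim-quant-census-2-g59/ASSEMBLY-G59.md`.  Theorems only,
standard axioms, no sorries, no definitions.

THE ASSEMBLY (`lightSliceCore_of_residual`).  In the binder of `LawDec.LightSliceCore` (census-2 g58, README V295) split on the light ⊗
cheap piece C of the light slice: (1) its top cell `h₁′ + h₂′` is a giant AND its upper cross cell `h₁′ + l₂′` is a conv-low ⟹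
`LightSliceLowCross` (pooled, census-1's LLG class); (2) top giant, no low cross, cheap cell more than 4 times as long as the light one ⟹
`LightSliceWide` (pooled, extreme aspect); (3) otherwise the slice is DEC PIECE-WISE: `lightSlice_decAtT_of_pieces` (census-2 g58) with
piece E ALWAYS DEC (`pieceE_decAtT`: no giant / giant pool / arm-2's low-cross heavy-long / arm-2's top-flipped light–heavy) and piece C DEC
by `pieceC_decAtT_noGiant` (typer g23's no-giant closure) or `pieceC_decAtT_topGiant` (arm-2's top-flipped light–light, aspect `≤ 4`).
The side conditions of the cell lemmas are read off the binder: the heavy cell is strictly longer than side 1's light segment and the cheap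
cell at least as long (tie-break + `l₂ < l₂′`, `h₂′ ≤ h₂`), the upper cross cells are mids (doubly deep), `T₁ + T₂ ≤ 2(l₁′ + h₂) ` (¬A2).
EXACT ASSEMBLY CENSUS (census-2 g59 `code/assembly_census.py`, M ≤ 6, 7 floors, ½+¼ grids; kit j161991 M ≤ 7 / j162002 M ≤ 8): 193 607 core
instances = piece-wise 191 469 (E: no giant 20 674 · giant pool 24 548 · low-cross heavy-long 45 203 · light–heavy 102 845; 0 failures,
0 side-condition failures) + `LightSliceLowCross` 1 934 + `LightSliceWide` 204.

* **`Quant.LawDec.lightSliceCore_of_residual : LightSliceLowCross → LightSliceWide → LightSliceCore`**.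
* `convClosedTAtomsOrd_of_residual`, `convClosedT_of_residual`, `sdecConvClosed_of_residual`, `treeBuiltDEC_of_residual`,
  **`Quant.treeDEC_of_residual`**, **`Quant.farTreeRow_of_residual : LightSliceLowCross → LightSliceWide → GatedConvEmptyFree → FarTreeRow`**,
  and the `GateMove` variants (lead g27's bridge `…QuantFarTreeRowOfLightSliceGateMove`).
STATE of the R8 law level after this file: **`FarTreeRow ⟸ LightSliceLowCross ∧ LightSliceWide ∧ (GatedConvEmptyFree ∨ GateMove)`** — two
explicit POOLED two-row transport families (census-1's cells) and leg (III).  HONEST: all four named statements are `@[conjecture]` (open);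
RATE class log* / honest sentence unchanged.

[this work]; nothing here is cited as a published result.  The gluing rows served [cite: KozmaNitzan2024, Conjecture 3 (p. 15)]; product
measure [cite: Grimmett1999, §1.3 p. 10].
-/

noncomputable section

namespace Summit.CriticalPhenomena.PercolationContinuityZ3.Theorems

namespace Quant

open Finset

/-- the two-point law `{lo, hi; g}` (as in `…QuantLawDEC`) -/
local notation3 "TP[" lo ", " hi ", " g ", " h "]" =>
  (g : ℝ) * (if (h : ℕ) = (hi : ℕ) then (1 : ℝ) else 0) + (1 - (g : ℝ)) * (if (h : ℕ) = (lo : ℕ) then (1 : ℝ) else 0)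

namespace LawDec

/-- **THE ASSEMBLY: `LightSliceCore ⟸ LightSliceLowCross ∧ LightSliceWide`.**  Off the two residual classes the light slice is DEC
piece-wise by landed cell lemmas (`pieceE_decAtT`, `pieceC_decAtT_noGiant`, `pieceC_decAtT_topGiant`, `lightSlice_decAtT_of_pieces`).
CONDITIONAL: the two hypotheses are `@[conjecture]`. [this work] -/
theorem lightSliceCore_of_residual (hR₁ : LightSliceLowCross) (hR₂ : LightSliceWide) : LightSliceCore := by
  intro x T₁ T₂ M₁ M₂ j l₁ h₁ l₁' h₁' l₂ h₂ l₂' h₂' hx0 hx1 hj hd₁ hd₂ ho₁ ho₂ ho₃ ho₄ hw₁ hw₂ hb₁ hb₂ hdeep₁ hdeep₂ hA2 htie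
  have hd₁' := hd₁
  have hd₂' := hd₂
  obtain ⟨-, -, -, -, -, -, b2, b3, b4, b5, -, c2, -⟩ := hd₁'
  obtain ⟨-, a2', a3', a4', a5', -, b2', b3', b4', b5', -, c2', c1'⟩ := hd₂'
  obtain ⟨-, hlt₁'⟩ := hd₁.lt_of
  obtain ⟨hlt₂, hlt₂'⟩ := hd₂.lt_of
  by_cases htop : h₁' + h₂' ≤ j
  · -- piece-wise, piece C without a giant
    refine lightSlice_decAtT_of_pieces x T₁ T₂ M₁ M₂ j l₁' h₁' l₂ h₂ l₂' h₂' _ hx0 hx1 hd₂ ?_ ?_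
    · exact pieceE_decAtT x T₁ T₂ j M₁ M₂ l₁' h₁' l₂ h₂ hx0 hx1 hj b2 b3 b5 b4 c2 a2' a3' a5' a4' c1' (by omega) (by omega)
        (by have : ((h₂' : ℕ) : ℝ) ≤ h₂ := by exact_mod_cast ho₄
            linarith)
    · exact pieceC_decAtT_noGiant x T₁ T₂ j M₁ M₂ l₁' h₁' l₂' h₂' hx0 hx1 b2 b3 b5 b4 b2' b3' b5' b4' htop
  push Not at htop
  by_cases hlow : 2 * ((h₁' : ℝ) + l₂') < T₁ + T₂
  · -- the low-cross residue
    exact hR₁ x T₁ T₂ M₁ M₂ j l₁ h₁ l₁' h₁' l₂ h₂ l₂' h₂' hx0 hx1 hj hd₁ hd₂ ho₁ ho₂ ho₃ ho₄ hw₁ hw₂ hb₁ hb₂ hdeep₁ hdeep₂ hA2 htie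
      (by omega) hlow
  push Not at hlow
  by_cases hwide : 4 * (h₁' - l₁') < h₂' - l₂'
  · -- the wide residue
    exact hR₂ x T₁ T₂ M₁ M₂ j l₁ h₁ l₁' h₁' l₂ h₂ l₂' h₂' hx0 hx1 hj hd₁ hd₂ ho₁ ho₂ ho₃ ho₄ hw₁ hw₂ hb₁ hb₂ hdeep₁ hdeep₂ hA2 htie
      (by omega) hlow hwide
  push Not at hwide
  -- piece-wise, piece C top-flipped with aspect ≤ 4
  refine lightSlice_decAtT_of_pieces x T₁ T₂ M₁ M₂ j l₁' h₁' l₂ h₂ l₂' h₂' _ hx0 hx1 hd₂ ?_ ?_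
  · exact pieceE_decAtT x T₁ T₂ j M₁ M₂ l₁' h₁' l₂ h₂ hx0 hx1 hj b2 b3 b5 b4 c2 a2' a3' a5' a4' c1' (by omega) (by omega)
      (by have : ((h₂' : ℕ) : ℝ) ≤ h₂ := by exact_mod_cast ho₄
          linarith)
  · exact pieceC_decAtT_topGiant x T₁ T₂ j M₁ M₂ l₁' h₁' l₂' h₂' hx0 hx1 b2 b3 b5 b4 c2 b2' b3' b5' b4' c2' (by omega) hwide
      (by omega) hdeep₁ hlow hA2

/-- **`ConvClosedTAtomsOrd` ⟸ the pooled residue.** [this work] -/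
theorem convClosedTAtomsOrd_of_residual (hR₁ : LightSliceLowCross) (hR₂ : LightSliceWide) : ConvClosedTAtomsOrd :=
  convClosedTAtomsOrd_of_lightSliceCore (lightSliceCore_of_residual hR₁ hR₂)

/-- **`ConvClosedT` ⟸ the pooled residue** — statement (II) of the R8 law level from two explicit pooled cell families. [this work] -/
theorem convClosedT_of_residual (hR₁ : LightSliceLowCross) (hR₂ : LightSliceWide) : ConvClosedT :=
  convClosedT_of_lightSliceCore (lightSliceCore_of_residual hR₁ hR₂)

/-- **`SDECConvClosed` ⟸ residue ∧ (III).** [this work] -/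
theorem sdecConvClosed_of_residual (hR₁ : LightSliceLowCross) (hR₂ : LightSliceWide) (hIII : GatedConvEmptyFree) : SDECConvClosed :=
  sdecConvClosed_of_lightSliceCore (lightSliceCore_of_residual hR₁ hR₂) hIII

/-- **`SDECConvClosed` ⟸ residue ∧ `GateMove`.** [this work] -/
theorem sdecConvClosed_of_residual_gateMove (hR₁ : LightSliceLowCross) (hR₂ : LightSliceWide) (hG : GateMove) : SDECConvClosed :=
  sdecConvClosed_of_lightSliceCore_gateMove (lightSliceCore_of_residual hR₁ hR₂) hG

/-- **`TreeBuiltDEC` ⟸ residue ∧ (III).** [this work] -/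
theorem treeBuiltDEC_of_residual (hR₁ : LightSliceLowCross) (hR₂ : LightSliceWide) (hIII : GatedConvEmptyFree) : TreeBuiltDEC :=
  treeBuiltDEC_of_lightSliceCore (lightSliceCore_of_residual hR₁ hR₂) hIII

/-- **`TreeBuiltDEC` ⟸ residue ∧ `GateMove`.** [this work] -/
theorem treeBuiltDEC_of_residual_gateMove (hR₁ : LightSliceLowCross) (hR₂ : LightSliceWide) (hG : GateMove) : TreeBuiltDEC :=
  treeBuiltDEC_of_lightSliceCore_gateMove (lightSliceCore_of_residual hR₁ hR₂) hG

end LawDec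

/-- **`Quant.TreeDEC` ⟸ residue ∧ (III).** [this work] -/
theorem treeDEC_of_residual (hR₁ : LawDec.LightSliceLowCross) (hR₂ : LawDec.LightSliceWide) (hIII : LawDec.GatedConvEmptyFree) :
    TreeDEC :=
  treeDEC_of_lightSliceCore (LawDec.lightSliceCore_of_residual hR₁ hR₂) hIII

/-- **`Quant.TreeDEC` ⟸ residue ∧ `GateMove`.** [this work] -/
theorem treeDEC_of_residual_gateMove (hR₁ : LawDec.LightSliceLowCross) (hR₂ : LawDec.LightSliceWide) (hG : LawDec.GateMove) :
    TreeDEC :=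
  treeDEC_of_lightSliceCore_gateMove (LawDec.lightSliceCore_of_residual hR₁ hR₂) hG

/-- **`Quant.FarTreeRow` ⟸ `LightSliceLowCross ∧ LightSliceWide ∧ GatedConvEmptyFree`** — FAR on trees from the two pooled cell families of the
light-slice core and Conjecture E.  CONDITIONAL: all three hypotheses are `@[conjecture]`. [this work] -/
theorem farTreeRow_of_residual (hR₁ : LawDec.LightSliceLowCross) (hR₂ : LawDec.LightSliceWide) (hIII : LawDec.GatedConvEmptyFree) :
    FarTreeRow :=
  farTreeRow_of_lightSliceCore (LawDec.lightSliceCore_of_residual hR₁ hR₂) hIII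

/-- **`Quant.FarTreeRow` ⟸ `LightSliceLowCross ∧ LightSliceWide ∧ GateMove`** (lead g27's bridge).  CONDITIONAL. [this work] -/
theorem farTreeRow_of_residual_gateMove (hR₁ : LawDec.LightSliceLowCross) (hR₂ : LawDec.LightSliceWide) (hG : LawDec.GateMove) :
    FarTreeRow :=
  farTreeRow_of_lightSliceCore_gateMove (LawDec.lightSliceCore_of_residual hR₁ hR₂) hG

end Quant

end Summit.CriticalPhenomena.PercolationContinuityZ3.Theorems
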